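import Summits.QuantumFields.YangMills.Theorems.BalabanUVNodesN21GappedTopCut13CoPHDefs
import Summits.QuantumFields.YangMills.Theorems.BalabanUVNodesN21TopLetteredReading13CoPHDefs

/-!
# N21 (NE7c) · THE GAPPED TOP-LETTERED SPINE READING `crGap₁₃VAt K₀ jcut ρ n : SpineReading₁₃CoPH N` — definition lane: R1's top-lettered reading `crTop₁₃VAt` field for
# field, EXCEPT that the depth is selected by the TWO-SIDED badness and the shell parts are the fibre sums of the TWO-SIDED COLLAR SHELLS `topGapShellAt(θ_{i⋆+2}, θ_{i⋆+1}, θ_{i⋆})`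
# around the selected middle letter `θ_{i⋆+1}` — the reading on which `KeyedShellWeight` is a THEOREM with NO anti-concentration AND both sides of the cut are banded
# (companion `…GappedTopReading13CoPH`)

R134 seat `pub-ymgap-dag-n21-d` (g11), node N21 = NE7c, strategy s2; lane K3⁷ `SpineGivenEndpointR13SepCoPH` (stmt-QuantumFields-20544, `--supports … --as helper`;
COUNT-NEUTRAL).  DEFINITION LANE; NO estimate.  Imports this seat's U1 `…GappedTopCut13CoPHDefs` (`topGapShellAt`) and R1 `…TopLetteredReading13CoPHDefs` (p608974 + v1.1:
`topTermAtLevel`, the letter types, n20-d's `crOfRecord₁₃V` vocabulary `classSet₁₃ ∕ keyA₁₃ ∕ keyB₁₃ ∕ badClass₁₃`, the canonical weights `wInf ∕ wshInf ∕ deltaCan`).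

WHAT IS DEFINED (all at a `CoPH`-keyed Stage-13 tuple `(F, θ, hP, g₀, os)`, offset `K₀`, comparison `K`, source `t`; dials: width `ρ : ℕ → ℝ`, depth budget `n : ℕ → ℕ`).
* `topGapShellAtLevel` — the two-sided collar shell of a history at its own level (`0` at level `0`, U1's `topGapShellAt … k` at level `k + 1`).
* `gapShellSumA₁₃ ∕ gapShellSumB₁₃` — the two runs' total collar-shell masses at depth `i` (collar `(θ_{i+2}, θ_i)` about `θ_{i+1}`); `gapBadness₁₃` (normalised by the runs'
  partition functions); ★ `selGapDepth₁₃` — an argmin over `i ≤ n_K` (+ `_spec`, `_le`).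
* `gapWeightA₁₃ ∕ gapWeightB₁₃` — the keyed fibre sums of the top-lettered terms AT THE SELECTED MIDDLE LETTER `θ_{i⋆+1}` (R1's `topTermAtLevel`); `gapShellA₁₃ ∕ gapShellB₁₃` — the
  keyed fibre sums of the two-sided collar shells at the selected depth.
* `topGapCoreAtLevel`, `gapCoreA₁₃ ∕ gapCoreB₁₃` — the gapped CORES (level-polymorphic; keyed) with ★★ `gapWeightA₁₃_sub_gapShellA₁₃ = gapCoreA₁₃` (and B): N19′'s object on this
  road as a definite object (the (2.18) term with top small-field cubes at `θ_{i⋆+2}` and new large-field cubes failing at `θ_{i⋆}`).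
* ★★ `crGap₁₃VAt N K₀ jcut ρ n : SpineReading₁₃CoPH N` and `crGap₁₃V := crGap₁₃VAt N 0` — n20-d's `crOfRecord₁₃VAt` field for field (`ι`, `T`, `Bad`, `l₀ := 1`, `vol := F.side^4`,
  canonical `W ∕ Wsh ∕ δ`) with the gapped carriers; dictionary lemmas (`rfl`).

HONEST FRAMING (binding).  Definitions; NO estimate; the reading is NOT the K3 skeleton's `PinnedAtLive` pin (which names `crOfRecord₁₃V`, print's `ε`; a pin admitting a
selected-letter reading is plan's decision — LOCATED); only the top step's (2.17)∕(3.2) factor family is re-lettered; the common-refinement comparison of design (i) is the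
consumer's; no `Provisos₁₃CoPH` inhabitant claimed (K0⁷ open); NE7c NOT PRINTED ∕ NOT proved at print's thresholds; N21 NOT discharged; K3⁷ NOT claimed; counts UNMOVED (typed
28∕28 · discharged 5∕27); never a count claim.  No `sorry`, no `axiom`, no `instance`, no `notation`.  One finite four-torus programme at fixed `ε` — NOT ℝ⁴, NOT OS, NOT a mass
gap, NOT the Clay problem.
-/

noncomputable section

open scoped BigOperators
open Finset MeasureTheory

namespace Summit.QuantumFields.YangMills.Theorems.N21ShellSplitOfRecord13CoPH

open Literature.MathematicalPhysics.QuantumFieldTheory.Balaban1983to89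
open Literature.MathematicalPhysics.QuantumFieldTheory.Balaban1983to89.T4Continuum
open Literature.MathematicalPhysics.QuantumFieldTheory.Balaban1983to89.Node00
open YMDAG.UVSplit (SpineReading₁₃CoPH keyA₁₃ keyB₁₃ runA₁₃ runB₁₃ histA₁₃ histB₁₃ classSet₁₃ badClass₁₃)
open Summit.QuantumFields.BalabanUV.T4Continuum.Spine
open Summit.QuantumFields.YangMills.BalabanUVNodes.SpineCanonicalWeights

/-! ## §36 The two-sided collar shell of a history, level-polymorphic -/

section Level

variable (F : T4Family) (N : ℕ) [NeZero N] (ϑ : Stage9Params F N) (D : FiniteEpsData F (SU N)) (g₀ : ℕ → ℝ) (os : List (ULoop F))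
  (p : B12.RunParams) (g : ℕ → ℝ)

/-- **THE TWO-SIDED COLLAR SHELL OF A HISTORY AT ITS OWN LEVEL** (collar `(θlo, θhi)` about the term's letter `θ`, source `t`): `0` at level `0` (no step, no cut), U1's
`topGapShellAt … k θlo θ θhi t` at level `k + 1`. [bookkeeping] -/
def topGapShellAtLevel (θlo θ θhi t : ℝ) : (j : ℕ) → SeqOfRecord F ϑ.ν ϑ.τ9.M g p.K j → ℝ
  | 0 => fun _ => 0
  | k + 1 => fun s' => topGapShellAt F N ϑ D g₀ os p g k θlo θ θhi t s'

/-- Face at level `0`. [bookkeeping] -/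
@[simp] theorem topGapShellAtLevel_zero (θlo θ θhi t : ℝ) (s : SeqOfRecord F ϑ.ν ϑ.τ9.M g p.K 0) :
    topGapShellAtLevel F N ϑ D g₀ os p g θlo θ θhi t 0 s = 0 := rfl

/-- Face at a successor level. [bookkeeping] -/
@[simp] theorem topGapShellAtLevel_succ (θlo θ θhi t : ℝ) (k : ℕ) (s' : SeqOfRecord F ϑ.ν ϑ.τ9.M g p.K (k + 1)) :
    topGapShellAtLevel F N ϑ D g₀ os p g θlo θ θhi t (k + 1) s' = topGapShellAt F N ϑ D g₀ os p g k θlo θ θhi t s' := rfl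

/-- **THE GAPPED CORE OF A HISTORY AT ITS OWN LEVEL** (collar `(θlo, θhi)`, source `t`): at level `0` the record's class weight (no step, no cut), at level `k + 1` U1's
`topGapCoreAt … k θlo θhi t` — the (2.18) term whose top small-field cubes pass at `θlo` and whose new large-field cubes fail at `θhi`: the definite object a consumer matching the
two runs' CORES on this road reads (T4IndicatorShell design (i), single-run half). [bookkeeping] -/
def topGapCoreAtLevel (θlo θhi t : ℝ) : (j : ℕ) → SeqOfRecord F ϑ.ν ϑ.τ9.M g p.K j → ℝ
  | 0 => fun s => classWeightOfDatum₉ F N ϑ D g₀ os p g 0 t s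
  | k + 1 => fun s' => topGapCoreAt F N ϑ D g₀ os p g k θlo θhi t s'

/-- Face at level `0`. [bookkeeping] -/
@[simp] theorem topGapCoreAtLevel_zero (θlo θhi t : ℝ) (s : SeqOfRecord F ϑ.ν ϑ.τ9.M g p.K 0) :
    topGapCoreAtLevel F N ϑ D g₀ os p g θlo θhi t 0 s = classWeightOfDatum₉ F N ϑ D g₀ os p g 0 t s := rfl

/-- Face at a successor level. [bookkeeping] -/
@[simp] theorem topGapCoreAtLevel_succ (θlo θhi t : ℝ) (k : ℕ) (s' : SeqOfRecord F ϑ.ν ϑ.τ9.M g p.K (k + 1)) :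
    topGapCoreAtLevel F N ϑ D g₀ os p g θlo θhi t (k + 1) s' = topGapCoreAt F N ϑ D g₀ os p g k θlo θhi t s' := rfl

/-- **TERM − TWO-SIDED SHELL = GAPPED CORE at every level** (level `0`: `term − 0`; level `k + 1`: U1's `topGapShellAt := topClassWeightAt − topGapCoreAt`). [bookkeeping] -/
theorem topTermAtLevel_sub_topGapShellAtLevel (θlo θ θhi t : ℝ) :
    ∀ (j : ℕ) (s : SeqOfRecord F ϑ.ν ϑ.τ9.M g p.K j),
      topTermAtLevel F N ϑ D g₀ os p g θ t j s - topGapShellAtLevel F N ϑ D g₀ os p g θlo θ θhi t j s = topGapCoreAtLevel F N ϑ D g₀ os p g θlo θhi t j s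
  | 0, s => by simp
  | k + 1, s' => by simp [topGapShellAt]

end Level

/-! ## §37 At the `CoPH`-keyed Stage-13 record: collar-shell masses, two-sided badness, the selected depth, the gapped carriers, the reading -/

section Reading

variable {F : T4Family} {N : ℕ} [NeZero N]

/-- **RUN A's TOTAL COLLAR-SHELL MASS AT DEPTH `i`** (comparison `K`, top `K₀ + K`, width `ρ K`, source `t`; collar `(θ_{i+2}, θ_i)` about the letter `θ_{i+1}`). [bookkeeping] -/
def gapShellSumA₁₃ (θ : Stage13HParams F N) (hP : θ.Provisos₁₃CoPH F N) (K₀ : ℕ) (g₀ : ℕ → ℝ) (os : List (ULoop F)) (ρ : ℕ → ℝ) (K i : ℕ) (t : ℝ) : ℝ :=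
  ∑ s : SeqOfRecord F θ.ν θ.τ9.M (histA₁₃ θ K₀ g₀ K) (K₀ + K) (K₀ + K),
    topGapShellAtLevel F N θ.toStage9Params (datumOfRecord₁₃CoPH F N θ hP) g₀ os (runA₁₃ F K₀ g₀ K) (histA₁₃ θ K₀ g₀ K)
      (cutGrid θ.ν (histA₁₃ θ K₀ g₀ K) (K₀ + K) (ρ K) (i + 2)) (cutGrid θ.ν (histA₁₃ θ K₀ g₀ K) (K₀ + K) (ρ K) (i + 1))
      (cutGrid θ.ν (histA₁₃ θ K₀ g₀ K) (K₀ + K) (ρ K) i) t (K₀ + K) s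

/-- **RUN B's TOTAL COLLAR-SHELL MASS AT DEPTH `i`** (top `K₀ + K + 1`). [bookkeeping] -/
def gapShellSumB₁₃ (θ : Stage13HParams F N) (hP : θ.Provisos₁₃CoPH F N) (K₀ : ℕ) (g₀ : ℕ → ℝ) (os : List (ULoop F)) (ρ : ℕ → ℝ) (K i : ℕ) (t : ℝ) : ℝ :=
  ∑ s' : SeqOfRecord F θ.ν θ.τ9.M (histB₁₃ θ K₀ g₀ K) (K₀ + K + 1) (K₀ + K + 1),
    topGapShellAtLevel F N θ.toStage9Params (datumOfRecord₁₃CoPH F N θ hP) g₀ os (runB₁₃ F K₀ g₀ K) (histB₁₃ θ K₀ g₀ K)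
      (cutGrid θ.ν (histB₁₃ θ K₀ g₀ K) (K₀ + K + 1) (ρ K) (i + 2)) (cutGrid θ.ν (histB₁₃ θ K₀ g₀ K) (K₀ + K + 1) (ρ K) (i + 1))
      (cutGrid θ.ν (histB₁₃ θ K₀ g₀ K) (K₀ + K + 1) (ρ K) i) t (K₀ + K + 1) s'

/-- **THE TWO-SIDED BADNESS OF A DEPTH**: the two runs' collar-shell masses at depth `i`, each normalised by its run's dressed partition function (`x ∕ 0 = 0`). [bookkeeping] -/
def gapBadness₁₃ (θ : Stage13HParams F N) (hP : θ.Provisos₁₃CoPH F N) (K₀ : ℕ) (g₀ : ℕ → ℝ) (os : List (ULoop F)) (ρ : ℕ → ℝ) (K : ℕ) (t : ℝ) (i : ℕ) : ℝ :=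
  gapShellSumA₁₃ θ hP K₀ g₀ os ρ K i t / T4GenFunBounds.schemeZ ((datumOfRecord₁₃CoPH F N θ hP).scheme g₀) os (K₀ + K) t +
    gapShellSumB₁₃ θ hP K₀ g₀ os ρ K i t / T4GenFunBounds.schemeZ ((datumOfRecord₁₃CoPH F N θ hP).scheme g₀) os (K₀ + K + 1) t

/-- ★ **THE SELECTED DEPTH** `i⋆(K, t) ≤ n`: an argmin of the two-sided badness over the depths `0, …, n`. [bookkeeping] -/
def selGapDepth₁₃ (θ : Stage13HParams F N) (hP : θ.Provisos₁₃CoPH F N) (K₀ : ℕ) (g₀ : ℕ → ℝ) (os : List (ULoop F)) (ρ : ℕ → ℝ) (n K : ℕ) (t : ℝ) : ℕ :=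
  Classical.choose ((Finset.range (n + 1)).exists_min_image (gapBadness₁₃ θ hP K₀ g₀ os ρ K t) ⟨0, Finset.mem_range.2 (Nat.succ_pos n)⟩)

/-- Spec of the selected depth. [bookkeeping] -/
theorem selGapDepth₁₃_spec (θ : Stage13HParams F N) (hP : θ.Provisos₁₃CoPH F N) (K₀ : ℕ) (g₀ : ℕ → ℝ) (os : List (ULoop F)) (ρ : ℕ → ℝ) (n K : ℕ) (t : ℝ) :
    selGapDepth₁₃ θ hP K₀ g₀ os ρ n K t ∈ Finset.range (n + 1) ∧
      ∀ j ∈ Finset.range (n + 1), gapBadness₁₃ θ hP K₀ g₀ os ρ K t (selGapDepth₁₃ θ hP K₀ g₀ os ρ n K t) ≤ gapBadness₁₃ θ hP K₀ g₀ os ρ K t j :=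
  Classical.choose_spec ((Finset.range (n + 1)).exists_min_image (gapBadness₁₃ θ hP K₀ g₀ os ρ K t) ⟨0, Finset.mem_range.2 (Nat.succ_pos n)⟩)

/-- The selected depth is at most `n`. [bookkeeping] -/
theorem selGapDepth₁₃_le (θ : Stage13HParams F N) (hP : θ.Provisos₁₃CoPH F N) (K₀ : ℕ) (g₀ : ℕ → ℝ) (os : List (ULoop F)) (ρ : ℕ → ℝ) (n K : ℕ) (t : ℝ) :
    selGapDepth₁₃ θ hP K₀ g₀ os ρ n K t ≤ n :=
  Nat.lt_succ_iff.1 (Finset.mem_range.1 (selGapDepth₁₃_spec θ hP K₀ g₀ os ρ n K t).1)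

/-- **RUN A's GAPPED CLASS WEIGHT** at a key: the fibre sum along `keyA₁₃` of the top-lettered terms (R1's `topTermAtLevel`) at the selected MIDDLE letter
`θ⋆ = ε_{K₀+K}(1 − ρ_K)^{i⋆(K,t)+1}`. [bookkeeping] -/
def gapWeightA₁₃ (θ : Stage13HParams F N) (hP : θ.Provisos₁₃CoPH F N) (K₀ : ℕ) (g₀ : ℕ → ℝ) (os : List (ULoop F)) (ρ : ℕ → ℝ) (n : ℕ → ℕ)
    (K : ℕ) (t : ℝ) (x : Σ K, SiteSeqKey F (K₀ + K)) : ℝ :=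
  letI : ∀ Kc, DecidableEq (SiteSeqKey F Kc) := fun _ => Classical.decEq _
  ∑ s ∈ univ.filter (fun s => keyA₁₃ θ K₀ g₀ K s = x),
    topTermAtLevel F N θ.toStage9Params (datumOfRecord₁₃CoPH F N θ hP) g₀ os (runA₁₃ F K₀ g₀ K) (histA₁₃ θ K₀ g₀ K)
      (cutGrid θ.ν (histA₁₃ θ K₀ g₀ K) (K₀ + K) (ρ K) (selGapDepth₁₃ θ hP K₀ g₀ os ρ (n K) K t + 1)) t (K₀ + K) s

/-- **RUN B's GAPPED CLASS WEIGHT** at a key (top `K₀ + K + 1`, along `keyB₁₃`, the SAME depth). [bookkeeping] -/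
def gapWeightB₁₃ (θ : Stage13HParams F N) (hP : θ.Provisos₁₃CoPH F N) (K₀ : ℕ) (g₀ : ℕ → ℝ) (os : List (ULoop F)) (ρ : ℕ → ℝ) (n : ℕ → ℕ)
    (K : ℕ) (t : ℝ) (x : Σ K, SiteSeqKey F (K₀ + K)) : ℝ :=
  letI : ∀ Kc, DecidableEq (SiteSeqKey F Kc) := fun _ => Classical.decEq _
  ∑ s' ∈ univ.filter (fun s' => keyB₁₃ θ K₀ g₀ K s' = x),
    topTermAtLevel F N θ.toStage9Params (datumOfRecord₁₃CoPH F N θ hP) g₀ os (runB₁₃ F K₀ g₀ K) (histB₁₃ θ K₀ g₀ K)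
      (cutGrid θ.ν (histB₁₃ θ K₀ g₀ K) (K₀ + K + 1) (ρ K) (selGapDepth₁₃ θ hP K₀ g₀ os ρ (n K) K t + 1)) t (K₀ + K + 1) s'

/-- **RUN A's GAPPED SHELL PART** at a key: the fibre sum of the two-sided collar shells at the selected depth. [bookkeeping] -/
def gapShellA₁₃ (θ : Stage13HParams F N) (hP : θ.Provisos₁₃CoPH F N) (K₀ : ℕ) (g₀ : ℕ → ℝ) (os : List (ULoop F)) (ρ : ℕ → ℝ) (n : ℕ → ℕ)
    (K : ℕ) (t : ℝ) (x : Σ K, SiteSeqKey F (K₀ + K)) : ℝ :=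
  letI : ∀ Kc, DecidableEq (SiteSeqKey F Kc) := fun _ => Classical.decEq _
  ∑ s ∈ univ.filter (fun s => keyA₁₃ θ K₀ g₀ K s = x),
    topGapShellAtLevel F N θ.toStage9Params (datumOfRecord₁₃CoPH F N θ hP) g₀ os (runA₁₃ F K₀ g₀ K) (histA₁₃ θ K₀ g₀ K)
      (cutGrid θ.ν (histA₁₃ θ K₀ g₀ K) (K₀ + K) (ρ K) (selGapDepth₁₃ θ hP K₀ g₀ os ρ (n K) K t + 2))
      (cutGrid θ.ν (histA₁₃ θ K₀ g₀ K) (K₀ + K) (ρ K) (selGapDepth₁₃ θ hP K₀ g₀ os ρ (n K) K t + 1))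
      (cutGrid θ.ν (histA₁₃ θ K₀ g₀ K) (K₀ + K) (ρ K) (selGapDepth₁₃ θ hP K₀ g₀ os ρ (n K) K t)) t (K₀ + K) s

/-- **RUN B's GAPPED SHELL PART** at a key. [bookkeeping] -/
def gapShellB₁₃ (θ : Stage13HParams F N) (hP : θ.Provisos₁₃CoPH F N) (K₀ : ℕ) (g₀ : ℕ → ℝ) (os : List (ULoop F)) (ρ : ℕ → ℝ) (n : ℕ → ℕ)
    (K : ℕ) (t : ℝ) (x : Σ K, SiteSeqKey F (K₀ + K)) : ℝ :=
  letI : ∀ Kc, DecidableEq (SiteSeqKey F Kc) := fun _ => Classical.decEq _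
  ∑ s' ∈ univ.filter (fun s' => keyB₁₃ θ K₀ g₀ K s' = x),
    topGapShellAtLevel F N θ.toStage9Params (datumOfRecord₁₃CoPH F N θ hP) g₀ os (runB₁₃ F K₀ g₀ K) (histB₁₃ θ K₀ g₀ K)
      (cutGrid θ.ν (histB₁₃ θ K₀ g₀ K) (K₀ + K + 1) (ρ K) (selGapDepth₁₃ θ hP K₀ g₀ os ρ (n K) K t + 2))
      (cutGrid θ.ν (histB₁₃ θ K₀ g₀ K) (K₀ + K + 1) (ρ K) (selGapDepth₁₃ θ hP K₀ g₀ os ρ (n K) K t + 1))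
      (cutGrid θ.ν (histB₁₃ θ K₀ g₀ K) (K₀ + K + 1) (ρ K) (selGapDepth₁₃ θ hP K₀ g₀ os ρ (n K) K t)) t (K₀ + K + 1) s'

/-- **RUN A's GAPPED CORE at a key**: the fibre sum along `keyA₁₃` of the gapped cores at the selected collar — equals `gapWeightA₁₃ − gapShellA₁₃` (companion; the object
N19′ matches on this road). [bookkeeping] -/
def gapCoreA₁₃ (θ : Stage13HParams F N) (hP : θ.Provisos₁₃CoPH F N) (K₀ : ℕ) (g₀ : ℕ → ℝ) (os : List (ULoop F)) (ρ : ℕ → ℝ) (n : ℕ → ℕ)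
    (K : ℕ) (t : ℝ) (x : Σ K, SiteSeqKey F (K₀ + K)) : ℝ :=
  letI : ∀ Kc, DecidableEq (SiteSeqKey F Kc) := fun _ => Classical.decEq _
  ∑ s ∈ univ.filter (fun s => keyA₁₃ θ K₀ g₀ K s = x),
    topGapCoreAtLevel F N θ.toStage9Params (datumOfRecord₁₃CoPH F N θ hP) g₀ os (runA₁₃ F K₀ g₀ K) (histA₁₃ θ K₀ g₀ K)
      (cutGrid θ.ν (histA₁₃ θ K₀ g₀ K) (K₀ + K) (ρ K) (selGapDepth₁₃ θ hP K₀ g₀ os ρ (n K) K t + 2))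
      (cutGrid θ.ν (histA₁₃ θ K₀ g₀ K) (K₀ + K) (ρ K) (selGapDepth₁₃ θ hP K₀ g₀ os ρ (n K) K t)) t (K₀ + K) s

/-- **RUN B's GAPPED CORE at a key.** [bookkeeping] -/
def gapCoreB₁₃ (θ : Stage13HParams F N) (hP : θ.Provisos₁₃CoPH F N) (K₀ : ℕ) (g₀ : ℕ → ℝ) (os : List (ULoop F)) (ρ : ℕ → ℝ) (n : ℕ → ℕ)
    (K : ℕ) (t : ℝ) (x : Σ K, SiteSeqKey F (K₀ + K)) : ℝ :=
  letI : ∀ Kc, DecidableEq (SiteSeqKey F Kc) := fun _ => Classical.decEq _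
  ∑ s' ∈ univ.filter (fun s' => keyB₁₃ θ K₀ g₀ K s' = x),
    topGapCoreAtLevel F N θ.toStage9Params (datumOfRecord₁₃CoPH F N θ hP) g₀ os (runB₁₃ F K₀ g₀ K) (histB₁₃ θ K₀ g₀ K)
      (cutGrid θ.ν (histB₁₃ θ K₀ g₀ K) (K₀ + K + 1) (ρ K) (selGapDepth₁₃ θ hP K₀ g₀ os ρ (n K) K t + 2))
      (cutGrid θ.ν (histB₁₃ θ K₀ g₀ K) (K₀ + K + 1) (ρ K) (selGapDepth₁₃ θ hP K₀ g₀ os ρ (n K) K t)) t (K₀ + K + 1) s'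

/-- ★★ **RUN A: GAPPED CLASS WEIGHT − GAPPED SHELL PART = GAPPED CORE**, key by key, identically (no rows). [bookkeeping] -/
theorem gapWeightA₁₃_sub_gapShellA₁₃ (θ : Stage13HParams F N) (hP : θ.Provisos₁₃CoPH F N) (K₀ : ℕ) (g₀ : ℕ → ℝ) (os : List (ULoop F)) (ρ : ℕ → ℝ) (n : ℕ → ℕ)
    (K : ℕ) (t : ℝ) (x : Σ K, SiteSeqKey F (K₀ + K)) :
    gapWeightA₁₃ θ hP K₀ g₀ os ρ n K t x - gapShellA₁₃ θ hP K₀ g₀ os ρ n K t x = gapCoreA₁₃ θ hP K₀ g₀ os ρ n K t x := by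
  letI : ∀ Kc, DecidableEq (SiteSeqKey F Kc) := fun _ => Classical.decEq _
  unfold gapWeightA₁₃ gapShellA₁₃ gapCoreA₁₃
  rw [← Finset.sum_sub_distrib]
  exact Finset.sum_congr rfl fun s _ =>
    topTermAtLevel_sub_topGapShellAtLevel F N θ.toStage9Params (datumOfRecord₁₃CoPH F N θ hP) g₀ os (runA₁₃ F K₀ g₀ K) (histA₁₃ θ K₀ g₀ K) _ _ _ t (K₀ + K) s

/-- ★★ **RUN B: the same.** [bookkeeping] -/
theorem gapWeightB₁₃_sub_gapShellB₁₃ (θ : Stage13HParams F N) (hP : θ.Provisos₁₃CoPH F N) (K₀ : ℕ) (g₀ : ℕ → ℝ) (os : List (ULoop F)) (ρ : ℕ → ℝ) (n : ℕ → ℕ)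
    (K : ℕ) (t : ℝ) (x : Σ K, SiteSeqKey F (K₀ + K)) :
    gapWeightB₁₃ θ hP K₀ g₀ os ρ n K t x - gapShellB₁₃ θ hP K₀ g₀ os ρ n K t x = gapCoreB₁₃ θ hP K₀ g₀ os ρ n K t x := by
  letI : ∀ Kc, DecidableEq (SiteSeqKey F Kc) := fun _ => Classical.decEq _
  unfold gapWeightB₁₃ gapShellB₁₃ gapCoreB₁₃
  rw [← Finset.sum_sub_distrib]
  exact Finset.sum_congr rfl fun s' _ =>
    topTermAtLevel_sub_topGapShellAtLevel F N θ.toStage9Params (datumOfRecord₁₃CoPH F N θ hP) g₀ os (runB₁₃ F K₀ g₀ K) (histB₁₃ θ K₀ g₀ K) _ _ _ t (K₀ + K + 1) s'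

variable (N) in
/-- ★★ **THE GAPPED TOP-LETTERED SPINE READING AT OFFSET `K₀`** (persistence policy `jcut`, width letter `ρ`, depth letter `n`): dag-n20-d's `crOfRecord₁₃VAt` field for
field — index type, class set, bad class, `l₀ := 1`, `vol := F.side ^ 4`, canonical `W ∕ Wsh ∕ δ` — with the GAPPED carriers `gapWeightA₁₃ ∕ gapWeightB₁₃ ∕ gapShellA₁₃ ∕
gapShellB₁₃`. [bookkeeping] -/
def crGap₁₃VAt (K₀ : ℕ) (jcut : ℕ → ℕ) (ρ : WidthLetter₁₃CoPH N) (n : DepthLetter₁₃CoPH N) : SpineReading₁₃CoPH N := fun F θ hP g₀ os =>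
  { ι := Σ K, SiteSeqKey F (K₀ + K)
    dec := Classical.decEq _
    l₀ := 1
    vol := F.side ^ 4
    K₀ := K₀
    T := classSet₁₃ θ K₀ g₀
    A := gapWeightA₁₃ θ hP K₀ g₀ os (ρ F θ hP g₀ os) (n F θ hP g₀ os)
    B := gapWeightB₁₃ θ hP K₀ g₀ os (ρ F θ hP g₀ os) (n F θ hP g₀ os)
    shA := gapShellA₁₃ θ hP K₀ g₀ os (ρ F θ hP g₀ os) (n F θ hP g₀ os)
    shB := gapShellB₁₃ θ hP K₀ g₀ os (ρ F θ hP g₀ os) (n F θ hP g₀ os)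
    Bad := badClass₁₃ θ K₀ g₀ jcut
    W := wInf 1 (classSet₁₃ θ K₀ g₀) (gapWeightA₁₃ θ hP K₀ g₀ os (ρ F θ hP g₀ os) (n F θ hP g₀ os)) (gapWeightB₁₃ θ hP K₀ g₀ os (ρ F θ hP g₀ os) (n F θ hP g₀ os))
      (badClass₁₃ θ K₀ g₀ jcut)
    Wsh := wshInf 1 (classSet₁₃ θ K₀ g₀) (gapWeightA₁₃ θ hP K₀ g₀ os (ρ F θ hP g₀ os) (n F θ hP g₀ os)) (gapWeightB₁₃ θ hP K₀ g₀ os (ρ F θ hP g₀ os) (n F θ hP g₀ os))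
      (gapShellA₁₃ θ hP K₀ g₀ os (ρ F θ hP g₀ os) (n F θ hP g₀ os)) (gapShellB₁₃ θ hP K₀ g₀ os (ρ F θ hP g₀ os) (n F θ hP g₀ os))
    δ := letI : DecidableEq (Σ K, SiteSeqKey F (K₀ + K)) := Classical.decEq _
      deltaCan 1 (F.side ^ 4) (classSet₁₃ θ K₀ g₀) (badClass₁₃ θ K₀ g₀ jcut)
        (fun K t x => gapWeightA₁₃ θ hP K₀ g₀ os (ρ F θ hP g₀ os) (n F θ hP g₀ os) K t x - gapShellA₁₃ θ hP K₀ g₀ os (ρ F θ hP g₀ os) (n F θ hP g₀ os) K t x)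
        (fun K t x => gapWeightB₁₃ θ hP K₀ g₀ os (ρ F θ hP g₀ os) (n F θ hP g₀ os) K t x - gapShellB₁₃ θ hP K₀ g₀ os (ρ F θ hP g₀ os) (n F θ hP g₀ os) K t x) }

variable (N) in
/-- ★★ **THE GAPPED TOP-LETTERED SPINE READING** `crGap₁₃V := crGap₁₃VAt 0`. [bookkeeping] -/
def crGap₁₃V (jcut : ℕ → ℕ) (ρ : WidthLetter₁₃CoPH N) (n : DepthLetter₁₃CoPH N) : SpineReading₁₃CoPH N :=
  crGap₁₃VAt N 0 jcut ρ n

/-! ### The dictionary (all `rfl`) -/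

section Dictionary

variable (K₀ : ℕ) (jcut : ℕ → ℕ) (ρ : WidthLetter₁₃CoPH N) (n : DepthLetter₁₃CoPH N) (θ : Stage13HParams F N) (hP : θ.Provisos₁₃CoPH F N) (g₀ : ℕ → ℝ)
  (os : List (ULoop F))

/-- `ι`. [bookkeeping] -/
theorem crGap₁₃VAt_ι : (crGap₁₃VAt N K₀ jcut ρ n F θ hP g₀ os).ι = (Σ K, SiteSeqKey F (K₀ + K)) := rfl
/-- `l₀ = 1`. [bookkeeping] -/
@[simp] theorem crGap₁₃VAt_l₀ : (crGap₁₃VAt N K₀ jcut ρ n F θ hP g₀ os).l₀ = 1 := rfl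
/-- `vol = F.side ^ 4`. [bookkeeping] -/
theorem crGap₁₃VAt_vol : (crGap₁₃VAt N K₀ jcut ρ n F θ hP g₀ os).vol = F.side ^ 4 := rfl
/-- `K₀`. [bookkeeping] -/
@[simp] theorem crGap₁₃VAt_K₀ : (crGap₁₃VAt N K₀ jcut ρ n F θ hP g₀ os).K₀ = K₀ := rfl
/-- `T` = n20-d's keyed class set of record. [bookkeeping] -/
theorem crGap₁₃VAt_T : (crGap₁₃VAt N K₀ jcut ρ n F θ hP g₀ os).T = classSet₁₃ θ K₀ g₀ := rfl
/-- `A` = run A's gapped fibre sums. [bookkeeping] -/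
theorem crGap₁₃VAt_A : (crGap₁₃VAt N K₀ jcut ρ n F θ hP g₀ os).A = gapWeightA₁₃ θ hP K₀ g₀ os (ρ F θ hP g₀ os) (n F θ hP g₀ os) := rfl
/-- `B` = run B's gapped fibre sums. [bookkeeping] -/
theorem crGap₁₃VAt_B : (crGap₁₃VAt N K₀ jcut ρ n F θ hP g₀ os).B = gapWeightB₁₃ θ hP K₀ g₀ os (ρ F θ hP g₀ os) (n F θ hP g₀ os) := rfl
/-- `shA` = run A's gapped shell part. [bookkeeping] -/
theorem crGap₁₃VAt_shA : (crGap₁₃VAt N K₀ jcut ρ n F θ hP g₀ os).shA = gapShellA₁₃ θ hP K₀ g₀ os (ρ F θ hP g₀ os) (n F θ hP g₀ os) := rfl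
/-- `shB` = run B's gapped shell part. [bookkeeping] -/
theorem crGap₁₃VAt_shB : (crGap₁₃VAt N K₀ jcut ρ n F θ hP g₀ os).shB = gapShellB₁₃ θ hP K₀ g₀ os (ρ F θ hP g₀ os) (n F θ hP g₀ os) := rfl
/-- `Bad` = n20-d's persistence class of record. [bookkeeping] -/
theorem crGap₁₃VAt_Bad : (crGap₁₃VAt N K₀ jcut ρ n F θ hP g₀ os).Bad = badClass₁₃ θ K₀ g₀ jcut := rfl
/-- `W` = the canonical least relative weight of the bad class at the gapped carriers. [bookkeeping] -/
theorem crGap₁₃VAt_W : (crGap₁₃VAt N K₀ jcut ρ n F θ hP g₀ os).W =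
    wInf 1 (classSet₁₃ θ K₀ g₀) (gapWeightA₁₃ θ hP K₀ g₀ os (ρ F θ hP g₀ os) (n F θ hP g₀ os)) (gapWeightB₁₃ θ hP K₀ g₀ os (ρ F θ hP g₀ os) (n F θ hP g₀ os))
      (badClass₁₃ θ K₀ g₀ jcut) := rfl
/-- `Wsh` = the canonical relative shell weight at the gapped carriers. [bookkeeping] -/
theorem crGap₁₃VAt_Wsh : (crGap₁₃VAt N K₀ jcut ρ n F θ hP g₀ os).Wsh =
    wshInf 1 (classSet₁₃ θ K₀ g₀) (gapWeightA₁₃ θ hP K₀ g₀ os (ρ F θ hP g₀ os) (n F θ hP g₀ os)) (gapWeightB₁₃ θ hP K₀ g₀ os (ρ F θ hP g₀ os) (n F θ hP g₀ os))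
      (gapShellA₁₃ θ hP K₀ g₀ os (ρ F θ hP g₀ os) (n F θ hP g₀ os)) (gapShellB₁₃ θ hP K₀ g₀ os (ρ F θ hP g₀ os) (n F θ hP g₀ os)) := rfl
/-- The record object reads the offset-`0` form (`rfl`). [bookkeeping] -/
theorem crGap₁₃V_eq (jcut : ℕ → ℕ) (ρ : WidthLetter₁₃CoPH N) (n : DepthLetter₁₃CoPH N) : crGap₁₃V N jcut ρ n = crGap₁₃VAt N 0 jcut ρ n := rfl
/-- SAME index type, class set, bad class, `l₀`, `vol`, `K₀` AS R1's `crTop₁₃VAt` (and as n20-d's `crOfRecord₁₃VAt`) — the readings differ only in their carriers. [bookkeeping] -/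
theorem crGap₁₃VAt_T_eq_crTop₁₃VAt_T (ρ' : WidthLetter₁₃CoPH N) (n' : DepthLetter₁₃CoPH N) :
    (crGap₁₃VAt N K₀ jcut ρ n F θ hP g₀ os).T = (crTop₁₃VAt N K₀ jcut ρ' n' F θ hP g₀ os).T ∧
      (crGap₁₃VAt N K₀ jcut ρ n F θ hP g₀ os).Bad = (crTop₁₃VAt N K₀ jcut ρ' n' F θ hP g₀ os).Bad ∧
      (crGap₁₃VAt N K₀ jcut ρ n F θ hP g₀ os).vol = (crTop₁₃VAt N K₀ jcut ρ' n' F θ hP g₀ os).vol := ⟨rfl, rfl, rfl⟩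

end Dictionary

end Reading

end Summit.QuantumFields.YangMills.Theorems.N21ShellSplitOfRecord13CoPH

end
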